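import Literature.Computability.Complexity.ThresholdMonotoneKWDepth
import Literature.Computability.Complexity.ApproximateMajorityAmplification
import HarnessLib

/-!
# Proof of `thresholdMonoKWLogDepth` (Valiant 1984; Karchmer 1989, Thm. 4.1.1)

This file DISCHARGES the named fact
`Literature.Computability.Complexity.thresholdMonoKWLogDepth` (`ThresholdMonotoneKWDepth.lean`):
the monotone Karchmer–Wigderson game of every threshold function `th_k^n` (`n ≥ 1`) has a
deterministic protocol of depth `O(log n)` — here with the explicit constant
`depth ≤ 18 · (⌊log₂ n⌋ + 1)` (`KWTree.exists_solvesMono_thresholdFn`,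
`thresholdMonoKWLogDepth_holds`).

## Proof (Valiant's probabilistic amplification, `Maj₃` form, done on protocol trees)

Valiant (1984) builds a random monotone formula — a complete tree of a fixed amplifying gadget whose
leaves read independent random input positions — and shows that one fixing of the randomness
computes majority on all inputs.  We follow the `Maj₃`-gadget version of the scheme (Gupta–Mahajan
1996: the amplification function of `Maj₃` is `A(p) = 3p² − 2p³`, fixed point `1/2`; cf. the review
of Valiant's argument in Hoory–Magen–Pitassi, RANDOM 2006, §2, "amplification function
`A_H(p) = Pr[H(X₁,…,X_k) = 1]`"), and we carry it out directly on PROTOCOL TREES for the monotone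
KW game (`KWProtocol.lean`), so that no formula ↔ protocol conversion is needed:

* `th_k^n` is padded to `Maj_{2n+1}`: the virtual literals are the `n` variables, `n + 1 - k`
  constants `1` and `k` constants `0` (`ValiantMajority.V`, `ValiantMajority.virt`); an input of
  weight `≥ k` makes `≥ n + 1` of the `2n + 1` literals true, one of weight `< k` at most `n`
  (`ValiantMajority.card_virt`);
* level `0` of the family is a uniformly random virtual literal, level `j + 1` is `Maj₃` of three
  independent level-`j` members; for every member we also build a protocol tree over the REAL
  coordinates solving the monotone game of its pull-back (`Maj₃(f,g,h) = (f ∧ g) ∨ ((f ∨ g) ∧ h)`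
  costs three rounds, `ValiantMajority.majTree`; constant literals give void games).  The number
  of accepting members at a virtual assignment with a fraction `q` of true literals is EXACTLY
  `|T| · A^{(j)}(q)` (`ValiantMajority.frac_maj3`, exact counting — no probability theory);
* amplification: `A(1/2 + δ) ≥ 1/2 + (11/8) δ` for `0 ≤ δ ≤ 1/4` and `1 − A(1 − e) ≤ 3e²`, whence
  from the initial bias `1/(2(2n+1))` the error after `4⌊log₂ n⌋ + 6` levels is `≤ (1/3) · 2^{-n}`
  (`ValiantMajority.iterate_A_levels`; by the symmetry `A(1-p) = 1 - A(p)` the same bound serves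
  the rejecting side);
* Adleman's union bound over the `2^n` real inputs (`exists_seed_of_frac`,
  `ApproximateMajorityAmplification.lean`) fixes one member correct on every input; its protocol
  tree solves the monotone KW game of `th_k^n` in depth `≤ 3 · (4⌊log₂ n⌋ + 6) ≤ 18(⌊log₂ n⌋ + 1)`.

The thresholds `k = 0` and `k > n` are constant functions (void games, one leaf).

## References

* L. G. Valiant, *Short monotone formulae for the majority function*, J. Algorithms 5 (1984)
  363–366 [Valiant1984Majority] (the scheme; his gadget is `(x₁ ∨ x₂) ∧ (x₃ ∨ x₄)` with biased
  leaves, depth `5.3 log n`).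
* A. Gupta, S. Mahajan, *Using amplification to compute majority with small majority gates*,
  Comput. Complexity 6 (1996) 46–63 [GuptaMahajan1996] (`Maj₃` amplification, `A(p) = 3p² − 2p³`).
* S. Hoory, A. Magen, T. Pitassi, *Monotone circuits for the majority function*, RANDOM 2006,
  LNCS 4110, §2 (held: `book:diaz2006-…`, pp. 483–485: review of Valiant's argument).
* M. Karchmer, *Communication Complexity: A New Approach to Circuit Depth* (1989), Thm. 4.1.1
  [Karchmer1989] (the KW-game form `C(R^m[th_k^n]) = O(log n)`).
-/

set_option autoImplicit false

noncomputable section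

namespace Literature.Computability.Complexity

open Finset

namespace ValiantMajority

open KWTree

/-! ### The amplification function `A(p) = 3p² − 2p³` -/

/-- `A p = 3 p² − 2 p³`, the probability that `Maj₃` of three independent `p`-biased bits is `1`
(the amplification function of `Maj₃`). [cite: GuptaMahajan1996, §2 (amplification by Maj₃)] -/
def A (p : ℝ) : ℝ := 3 * p ^ 2 - 2 * p ^ 3

/-- Self-duality of `Maj₃`: `A(1 - p) = 1 - A(p)`. [cite: GuptaMahajan1996, §2 (amplification by Maj₃)] -/
theorem A_symm (p : ℝ) : A (1 - p) = 1 - A p := by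
  unfold A; ring

/-- `A` maps `[0,1]` into `[0, ∞)`. [folklore] -/
private theorem A_nonneg {p : ℝ} (_h0 : 0 ≤ p) (h1 : p ≤ 1) : 0 ≤ A p := by
  unfold A; nlinarith [mul_nonneg (sq_nonneg p) (by linarith : (0 : ℝ) ≤ 3 - 2 * p)]

/-- `A` maps `[0,1]` into `(-∞, 1]`. [folklore] -/
private theorem A_le_one {p : ℝ} (h0 : 0 ≤ p) (_h1 : p ≤ 1) : A p ≤ 1 := by
  unfold A; nlinarith [mul_nonneg (sq_nonneg (1 - p)) (by linarith : (0 : ℝ) ≤ 1 + 2 * p)]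

/-- `A` is monotone on `[0,1]`. [folklore] -/
private theorem A_mono {p q : ℝ} (hp : 0 ≤ p) (hpq : p ≤ q) (hq : q ≤ 1) : A p ≤ A q := by
  have hq0 : 0 ≤ q := hp.trans hpq
  have hp1 : p ≤ 1 := hpq.trans hq
  have key : 0 ≤ 3 * (p + q) - 2 * (p ^ 2 + p * q + q ^ 2) := by
    nlinarith [mul_nonneg hp (sub_nonneg.2 hp1), mul_nonneg hq0 (sub_nonneg.2 hq),
      mul_nonneg hp (sub_nonneg.2 hq)]
  unfold A
  nlinarith [mul_nonneg (sub_nonneg.2 hpq) key]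

/-- Phase 1 (linear amplification around the fixed point `1/2`):
`A(1/2 + δ) ≥ 1/2 + (11/8) δ` for `0 ≤ δ ≤ 1/4`.
[cite: Valiant1984Majority, proof of the Theorem (pp. 364–365), Maj₃ variant] -/
theorem A_half_step {δ : ℝ} (h0 : 0 ≤ δ) (h1 : δ ≤ 1 / 4) :
    1 / 2 + 11 / 8 * δ ≤ A (1 / 2 + δ) := by
  have h : 0 ≤ δ * ((1 / 4 - δ) * (1 / 4 + δ)) :=
    mul_nonneg h0 (mul_nonneg (by linarith) (by linarith))
  unfold A; nlinarith [h]

/-- Phase 2 (quadratic convergence near `1`): `1 − A(1 − e) ≤ 3 e²` for `0 ≤ e`.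
[cite: Valiant1984Majority, proof of the Theorem (pp. 364–365), Maj₃ variant] -/
theorem A_top_step {e : ℝ} (h0 : 0 ≤ e) : 1 - A (1 - e) ≤ 3 * e ^ 2 := by
  rw [A_symm]; unfold A; nlinarith [pow_nonneg h0 3]

/-- Iterates of `A` stay in `[0,1]`. [folklore] -/
private theorem iterate_A_mem (j : ℕ) {p : ℝ} (h0 : 0 ≤ p) (h1 : p ≤ 1) :
    0 ≤ A^[j] p ∧ A^[j] p ≤ 1 := by
  induction j with
  | zero => exact ⟨h0, h1⟩
  | succ j ih =>
    rw [Function.iterate_succ_apply']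
    exact ⟨A_nonneg ih.1 ih.2, A_le_one ih.1 ih.2⟩

/-- Iterates of `A` are monotone on `[0,1]`. [folklore] -/
private theorem iterate_A_mono (j : ℕ) {p q : ℝ} (hp : 0 ≤ p) (hpq : p ≤ q) (hq : q ≤ 1) :
    A^[j] p ≤ A^[j] q := by
  induction j with
  | zero => exact hpq
  | succ j ih =>
    rw [Function.iterate_succ_apply', Function.iterate_succ_apply']
    exact A_mono (iterate_A_mem j hp (hpq.trans hq)).1 ih (iterate_A_mem j (hp.trans hpq) hq).2

/-- Iterates of `A` are self-dual. [folklore] -/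
private theorem iterate_A_symm (j : ℕ) (p : ℝ) : A^[j] (1 - p) = 1 - A^[j] p := by
  induction j with
  | zero => rfl
  | succ j ih => rw [Function.iterate_succ_apply', Function.iterate_succ_apply', ih, A_symm]

/-- Phase 1 iterated: from bias `δ` the bias after `j` levels is `≥ min ((11/8)^j δ) (1/4)`.
[cite: Valiant1984Majority, proof of the Theorem (pp. 364–365), Maj₃ variant] -/
theorem iterate_A_phase1 (j : ℕ) {p δ : ℝ} (hδ : 0 ≤ δ) (hp : 1 / 2 + δ ≤ p) (hp1 : p ≤ 1) :
    1 / 2 + min ((11 / 8) ^ j * δ) (1 / 4) ≤ A^[j] p := by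
  induction j with
  | zero =>
    have : min ((11 / 8 : ℝ) ^ 0 * δ) (1 / 4) ≤ δ := by rw [pow_zero, one_mul]; exact min_le_left _ _
    simpa using (by linarith : 1 / 2 + min ((11 / 8 : ℝ) ^ 0 * δ) (1 / 4) ≤ p)
  | succ j ih =>
    set δj : ℝ := min ((11 / 8) ^ j * δ) (1 / 4) with hδj
    have hδj0 : 0 ≤ δj := le_min (by positivity) (by norm_num)
    have hδj1 : δj ≤ 1 / 4 := min_le_right _ _
    have hmem := iterate_A_mem j (by linarith : (0 : ℝ) ≤ p) hp1
    rw [Function.iterate_succ_apply']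
    have h1 : A (1 / 2 + δj) ≤ A (A^[j] p) := A_mono (by linarith) ih hmem.2
    have h2 := A_half_step hδj0 hδj1
    have h3 : min ((11 / 8 : ℝ) ^ (j + 1) * δ) (1 / 4) ≤ 11 / 8 * δj := by
      rcases le_total ((11 / 8 : ℝ) ^ j * δ) (1 / 4) with h | h
      · rw [hδj, min_eq_left h, pow_succ]
        nlinarith [min_le_left ((11 / 8 : ℝ) ^ j * (11 / 8) * δ) (1 / 4)]
      · rw [hδj, min_eq_right h]
        linarith [min_le_right ((11 / 8 : ℝ) ^ (j + 1) * δ) (1 / 4)]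
    linarith

/-- Phase 2 iterated: from `p ≥ 3/4` the error after `j` levels is `≤ (1/3) (3/4)^{2^j}`.
[cite: Valiant1984Majority, proof of the Theorem (pp. 364–365), Maj₃ variant] -/
theorem iterate_A_phase2 (j : ℕ) {p : ℝ} (hp : 3 / 4 ≤ p) (hp1 : p ≤ 1) :
    3 * (1 - A^[j] p) ≤ (3 / 4) ^ (2 ^ j) := by
  induction j with
  | zero => simp only [pow_zero, Function.iterate_zero, id_eq, pow_one]; linarith
  | succ j ih =>
    have hmem := iterate_A_mem j (by linarith : (0 : ℝ) ≤ p) hp1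
    have he0 : 0 ≤ 1 - A^[j] p := sub_nonneg.2 hmem.2
    rw [Function.iterate_succ_apply']
    have h1 : 1 - A (A^[j] p) ≤ 3 * (1 - A^[j] p) ^ 2 := by
      have := A_top_step he0
      rwa [sub_sub_cancel] at this
    have h2 : (3 * (1 - A^[j] p)) ^ 2 ≤ ((3 / 4 : ℝ) ^ (2 ^ j)) ^ 2 :=
      pow_le_pow_left₀ (by linarith) ih 2
    rw [pow_succ, pow_mul]
    nlinarith [h1, h2]

/-- Number of `Maj₃` levels used for arity `n`: `4 ⌊log₂ n⌋ + 6`.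
[cite: Valiant1984Majority, Theorem (p. 363), Maj₃ variant] -/
def levels (n : ℕ) : ℕ := 4 * Nat.log 2 n + 6

/-- The end-to-end amplification bound: from bias `≥ 1/2 + 1/(2(2n+1))` (i.e. `p ≥ (n+1)/(2n+1)`),
after `levels n` iterations the deficiency is `≤ (1/3) · 2^{-n}`.
[cite: Valiant1984Majority, proof of the Theorem (pp. 364–365), Maj₃ variant] -/
theorem iterate_A_levels {n : ℕ} {p : ℝ} (hp : ((n : ℝ) + 1) / (2 * n + 1) ≤ p) (hp1 : p ≤ 1) :
    1 - A^[levels n] p ≤ 1 / 3 * (1 / 2) ^ n := by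
  set L := Nat.log 2 n with hL
  have h2L : n < 2 ^ (L + 1) := Nat.lt_pow_succ_log_self one_lt_two n
  have h2L' : (n : ℝ) + 1 ≤ 2 ^ (L + 1) := by exact_mod_cast h2L
  have hn0 : (0 : ℝ) ≤ n := Nat.cast_nonneg n
  -- phase 1
  set δ : ℝ := 1 / (2 * (2 * n + 1)) with hδ
  have hδ0 : 0 ≤ δ := by positivity
  have hpδ : 1 / 2 + δ ≤ p := by
    have : (1 : ℝ) / 2 + δ = ((n : ℝ) + 1) / (2 * n + 1) := by
      rw [hδ]; field_simp; ring
    rw [this]; exact hp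
  have hph1 := iterate_A_phase1 (3 * (L + 1)) hδ0 hpδ hp1
  have hbig : 1 / 4 ≤ (11 / 8 : ℝ) ^ (3 * (L + 1)) * δ := by
    have h1 : (2 : ℝ) ^ (L + 1) ≤ (11 / 8 : ℝ) ^ (3 * (L + 1)) := by
      rw [pow_mul]
      exact pow_le_pow_left₀ (by norm_num) (by norm_num) _
    rw [hδ, ← div_eq_mul_one_div, le_div_iff₀ (by positivity)]
    linarith [h1, h2L']
  have h34 : 3 / 4 ≤ A^[3 * (L + 1)] p := by
    rw [min_eq_right hbig] at hph1; linarith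
  have hmem := iterate_A_mem (3 * (L + 1)) (by linarith : (0 : ℝ) ≤ p) hp1
  -- phase 2
  have hph2 := iterate_A_phase2 (L + 3) h34 hmem.2
  have hlev : levels n = (L + 3) + 3 * (L + 1) := by rw [levels, hL]; ring
  rw [hlev, Function.iterate_add_apply]
  have h4n : 4 * n ≤ 2 ^ (L + 3) := by
    have : 2 ^ (L + 3) = 4 * 2 ^ (L + 1) := by ring
    omega
  have hpow : (3 / 4 : ℝ) ^ (2 ^ (L + 3)) ≤ (1 / 2) ^ n :=
    calc (3 / 4 : ℝ) ^ (2 ^ (L + 3)) ≤ (3 / 4) ^ (4 * n) :=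
          pow_le_pow_of_le_one (by norm_num) (by norm_num) h4n
      _ = ((3 / 4) ^ 4) ^ n := by rw [pow_mul]
      _ ≤ (1 / 2) ^ n := pow_le_pow_left₀ (by norm_num) (by norm_num) n
  linarith

/-! ### The `Maj₃` protocol gadget -/

/-- `Maj₃(p,q,r) = (p ∧ q) ∨ ((p ∨ q) ∧ r)`. [cite: GuptaMahajan1996, §2 (amplification by Maj₃)] -/
def maj3 (p q r : Bool) : Bool := (p && q) || ((p || q) && r)

/-- The three-round monotone KW protocol for `Maj₃(f,g,h)` on top of protocols for `f`, `g`, `h`: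
Alice says whether `(f ∨ g) ∧ h` holds at her input, Bob names a false conjunct, and in the `f ∨ g`
branch Alice names a true disjunct (Karchmer–Wigderson simulation of a depth-`3` monotone formula).
[cite: KarchmerWigderson1990, §2 (proof of d_m(f) ≥ C(R_f^m))] -/
def majTree {ι : Type*} (f g h : (ι → Bool) → Bool) (P Q R : KWTree ι) : KWTree ι :=
  alice (fun x => (f x || g x) && h x) (bob (fun x => !g x) P Q)
    (bob (fun x => !h x) (alice g P Q) R)

/-- `majTree` solves the monotone game of `Maj₃(f,g,h)`.
[cite: KarchmerWigderson1990, §2 (proof of d_m(f) ≥ C(R_f^m))] -/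
theorem solvesMono_majTree {ι : Type*} {f g h : (ι → Bool) → Bool} {P Q R : KWTree ι}
    (hP : P.SolvesMono f) (hQ : Q.SolvesMono g) (hR : R.SolvesMono h) :
    (majTree f g h P Q R).SolvesMono fun x => maj3 (f x) (g x) (h x) :=
  solvesMono_alice_or (solvesMono_bob_and hP hQ)
    (solvesMono_bob_and (solvesMono_alice_or hP hQ) hR)

/-- `majTree` adds three rounds. [folklore] -/
private theorem depth_majTree_le {ι : Type*} (f g h : (ι → Bool) → Bool) {P Q R : KWTree ι} {D : ℕ}
    (hP : P.depth ≤ D) (hQ : Q.depth ≤ D) (hR : R.depth ≤ D) :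
    (majTree f g h P Q R).depth ≤ D + 3 := by
  simp only [majTree, depth_alice, depth_bob]
  omega

/-! ### Exact counting for `Maj₃` of three independent seeds -/

section Counting

variable {T : Type*} [Fintype T] (P : T → Bool)

/-- Splitting a sum by the value of a Boolean statistic. [folklore] -/
private theorem sum_apply_bool (φ : Bool → ℕ) :
    ∑ ω, φ (P ω) = (univ.filter fun ω => P ω = true).card * φ true +
      (univ.filter fun ω => P ω = false).card * φ false := by
  rw [← Finset.sum_filter_add_sum_filter_not univ (fun ω => P ω = true)]
  have h1 : ∑ ω ∈ univ.filter (fun ω => P ω = true), φ (P ω) =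
      ∑ _ω ∈ univ.filter (fun ω => P ω = true), φ true :=
    Finset.sum_congr rfl fun ω hω => by rw [(Finset.mem_filter.1 hω).2]
  have h2 : ∑ ω ∈ univ.filter (fun ω => ¬P ω = true), φ (P ω) =
      ∑ _ω ∈ univ.filter (fun ω => P ω = false), φ false := by
    refine Finset.sum_congr (Finset.filter_congr fun ω _ => by simp) fun ω hω => ?_
    rw [(Finset.mem_filter.1 hω).2]
  rw [h1, h2, Finset.sum_const, Finset.sum_const, smul_eq_mul, smul_eq_mul]

/-- `#P⁻¹(1) + #P⁻¹(0) = |T|`. [folklore] -/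
private theorem card_filter_true_add_false :
    (univ.filter fun ω => P ω = true).card + (univ.filter fun ω => P ω = false).card =
      Fintype.card T := by
  have := Finset.card_filter_add_card_filter_not (s := (univ : Finset T)) (fun ω => P ω = true)
  rw [Finset.card_univ] at this
  convert this using 3
  ext ω; simp

/-- `#{(ω₁,ω₂,ω₃) : Maj₃(P ω₁, P ω₂, P ω₃)} = F³ + 3 F² F̄` with `F = #P⁻¹(1)`, `F̄ = #P⁻¹(0)`
(exactly two or three of three independent draws). [cite: GuptaMahajan1996, §2 (amplification by Maj₃)] -/
theorem card_filter_maj3 :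
    (univ.filter fun ω : T × T × T => maj3 (P ω.1) (P ω.2.1) (P ω.2.2) = true).card =
      (univ.filter fun ω => P ω = true).card ^ 3 +
        3 * (univ.filter fun ω => P ω = true).card ^ 2 *
          (univ.filter fun ω => P ω = false).card := by
  set F := (univ.filter fun ω => P ω = true).card with hF
  set Fb := (univ.filter fun ω => P ω = false).card with hFb
  rw [Finset.card_filter, Fintype.sum_prod_type]
  simp_rw [Fintype.sum_prod_type]
  have step3 : ∀ a b : T, ∑ c, (if maj3 (P a) (P b) (P c) = true then 1 else 0) =
      F * (if maj3 (P a) (P b) true = true then 1 else 0) +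
        Fb * (if maj3 (P a) (P b) false = true then 1 else 0) := fun a b =>
    sum_apply_bool P fun z => if maj3 (P a) (P b) z = true then 1 else 0
  simp only [step3]
  have step2 : ∀ a : T, ∑ b, (F * (if maj3 (P a) (P b) true = true then 1 else 0) +
      Fb * (if maj3 (P a) (P b) false = true then 1 else 0)) =
      F * (F * (if maj3 (P a) true true = true then 1 else 0) +
        Fb * (if maj3 (P a) true false = true then 1 else 0)) +
      Fb * (F * (if maj3 (P a) false true = true then 1 else 0) +
        Fb * (if maj3 (P a) false false = true then 1 else 0)) := fun a =>
    sum_apply_bool P fun y => F * (if maj3 (P a) y true = true then 1 else 0) +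
      Fb * (if maj3 (P a) y false = true then 1 else 0)
  simp only [step2]
  rw [sum_apply_bool P fun x => F * (F * (if maj3 x true true = true then 1 else 0) +
        Fb * (if maj3 x true false = true then 1 else 0)) +
      Fb * (F * (if maj3 x false true = true then 1 else 0) +
        Fb * (if maj3 x false false = true then 1 else 0))]
  simp [maj3]
  ring

/-- The same count as a fraction: the acceptance fraction of `Maj₃` of three independent draws is
`A` of the acceptance fraction. [cite: GuptaMahajan1996, §2 (amplification by Maj₃)] -/
theorem frac_maj3 [Nonempty T] :
    ((univ.filter fun ω : T × T × T => maj3 (P ω.1) (P ω.2.1) (P ω.2.2) = true).card : ℝ) =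
      Fintype.card (T × T × T) *
        A (((univ.filter fun ω => P ω = true).card : ℝ) / Fintype.card T) := by
  have hT : (0 : ℝ) < Fintype.card T := Nat.cast_pos.2 Fintype.card_pos
  have hsum := card_filter_true_add_false P
  have hFb : ((univ.filter fun ω => P ω = false).card : ℝ) =
      Fintype.card T - (univ.filter fun ω => P ω = true).card := by
    rw [eq_sub_iff_add_eq]; exact_mod_cast (by rw [add_comm]; exact hsum)
  rw [card_filter_maj3, Fintype.card_prod, Fintype.card_prod]
  push_cast
  rw [hFb]
  unfold A
  field_simp
  ring

end Counting

/-! ### Virtual literals (padding `th_k^n` to `Maj_{2n+1}`) and the level families -/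

/-- Virtual literal universe: the `n` variables, `n + 1 - k` constants `1`, `k` constants `0`.
[cite: Valiant1984Majority, Theorem (p. 363), padding to majority] -/
abbrev V (n k : ℕ) : Type := Fin n ⊕ (Fin (n + 1 - k) ⊕ Fin k)

/-- The padded (virtual) assignment of a real input.
[cite: Valiant1984Majority, Theorem (p. 363), padding to majority] -/
def virt (n k : ℕ) (x : Fin n → Bool) : V n k → Bool :=
  Sum.elim x (Sum.elim (fun _ => true) (fun _ => false))

/-- `|V| = 2n + 1` (for `k ≤ n + 1`). [folklore] -/
private theorem card_V {n k : ℕ} (hk : k ≤ n + 1) : Fintype.card (V n k) = 2 * n + 1 := by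
  simp only [V, Fintype.card_sum, Fintype.card_fin]
  omega

/-- The padded assignment of `x` has exactly `|x| + (n + 1 - k)` true literals. [folklore] -/
private theorem card_virt (n k : ℕ) (x : Fin n → Bool) :
    (univ.filter fun v : V n k => virt n k x v = true).card = hammingWeight x + (n + 1 - k) := by
  rw [Finset.card_filter, Fintype.sum_sum_type, Fintype.sum_sum_type]
  have e1 : (∑ i : Fin n, if virt n k x (Sum.inl i) = true then 1 else 0) = hammingWeight x := by
    unfold hammingWeight; rw [Finset.card_filter]; rfl
  have e2 : (∑ c : Fin (n + 1 - k), if virt n k x (Sum.inr (Sum.inl c)) = true then 1 else 0) =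
      n + 1 - k := by
    have h : ∀ c : Fin (n + 1 - k),
        (if virt n k x (Sum.inr (Sum.inl c)) = true then 1 else 0) = 1 := fun _ => rfl
    simp only [h, Finset.sum_const, Finset.card_univ, Fintype.card_fin, smul_eq_mul, mul_one]
  have e3 : (∑ c : Fin k, if virt n k x (Sum.inr (Sum.inr c)) = true then 1 else 0) = 0 := by
    have h : ∀ c : Fin k, (if virt n k x (Sum.inr (Sum.inr c)) = true then 1 else 0) = 0 :=
      fun _ => rfl
    simp only [h, Finset.sum_const_zero]
  rw [e1, e2, e3, add_zero]

/-- **The level families** (Valiant's random formulas, as finite families of protocol trees).  For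
every `j` there is a finite nonempty seed type `T` and, for each seed, a Boolean function of the
virtual literals together with a protocol tree over the REAL coordinates of depth `≤ 3j` solving the
monotone KW game of its pull-back, such that at every virtual assignment the number of accepting seeds
is exactly `|T| · A^{(j)}(fraction of true literals)`.
[cite: Valiant1984Majority, proof of the Theorem (pp. 364–365), Maj₃ variant] -/
theorem exists_level {n : ℕ} (k : ℕ) (hn : 1 ≤ n) : ∀ j : ℕ,
    ∃ (T : Type) (_ : Fintype T) (_ : Nonempty T) (ev : T → (V n k → Bool) → Bool)
      (tr : T → KWTree (Fin n)),
      (∀ ω, (tr ω).depth ≤ 3 * j) ∧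
      (∀ ω, (tr ω).SolvesMono fun x => ev ω (virt n k x)) ∧
      ∀ a : V n k → Bool, ((univ.filter fun ω => ev ω a = true).card : ℝ) =
        Fintype.card T *
          A^[j] (((univ.filter fun v => a v = true).card : ℝ) / Fintype.card (V n k))
  | 0 => by
    have hV : (0 : ℝ) < Fintype.card (V n k) := by
      have : Nonempty (V n k) := ⟨Sum.inl ⟨0, hn⟩⟩
      exact Nat.cast_pos.2 Fintype.card_pos
    refine ⟨V n k, inferInstance, ⟨Sum.inl ⟨0, hn⟩⟩, fun v a => a v,
      Sum.elim (fun i => leaf i) (fun _ => leaf ⟨0, hn⟩), fun ω => ?_, fun ω => ?_, fun a => ?_⟩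
    · rcases ω with i | c <;> simp
    · rcases ω with i | c | c
      · simpa [virt] using solvesMono_leaf (ι := Fin n) i
      · intro a b ha hb; simp [virt] at hb
      · intro a b ha hb; simp [virt] at ha
    · rw [Function.iterate_zero_apply, mul_div_cancel₀ _ hV.ne']
  | j + 1 => by
    obtain ⟨T, _, _, ev, tr, hd, hs, hc⟩ := exists_level k hn j
    refine ⟨T × T × T, inferInstance, inferInstance,
      fun ω a => maj3 (ev ω.1 a) (ev ω.2.1 a) (ev ω.2.2 a),
      fun ω => majTree (fun x => ev ω.1 (virt n k x)) (fun x => ev ω.2.1 (virt n k x))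
        (fun x => ev ω.2.2 (virt n k x)) (tr ω.1) (tr ω.2.1) (tr ω.2.2),
      fun ω => ?_, fun ω => ?_, fun a => ?_⟩
    · have := depth_majTree_le (fun x => ev ω.1 (virt n k x)) (fun x => ev ω.2.1 (virt n k x))
        (fun x => ev ω.2.2 (virt n k x)) (hd ω.1) (hd ω.2.1) (hd ω.2.2)
      omega
    · exact solvesMono_majTree (hs ω.1) (hs ω.2.1) (hs ω.2.2)
    · rw [frac_maj3 (fun ω => ev ω a), hc a, Function.iterate_succ_apply']
      have hT : (0 : ℝ) < Fintype.card T := Nat.cast_pos.2 Fintype.card_pos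
      rw [mul_div_cancel_left₀ _ hT.ne']

end ValiantMajority

open ValiantMajority in
/-- **Valiant 1984 / Karchmer 1989 Thm. 4.1.1 with an explicit constant (kernel-checked).** For every
`n ≥ 1` and every `k`, the monotone Karchmer–Wigderson game of `th_k^n` has a protocol tree of depth
`≤ 18 (⌊log₂ n⌋ + 1)`.
[cite: Valiant1984Majority, Theorem (p. 363)] [cite: Karchmer1989, §4.1 Thm 4.1.1 (p. 29)] -/
theorem KWTree.exists_solvesMono_thresholdFn (n k : ℕ) (hn : 1 ≤ n) :
    ∃ T : KWTree (Fin n), T.depth ≤ 18 * (Nat.log 2 n + 1) ∧ T.SolvesMono (thresholdFn n k) := by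
  by_cases hk0 : k = 0
  · refine ⟨KWTree.leaf ⟨0, hn⟩, by simp, KWTree.solvesMono_of_forall_eq_true _ fun x => ?_⟩
    simp [thresholdFn, hk0]
  by_cases hkn : n < k
  · exact ⟨KWTree.leaf ⟨0, hn⟩, by simp,
      KWTree.solvesMono_of_forall_eq_false _ (thresholdFn_eq_false_of_arity_lt hkn)⟩
  have hk1 : k ≤ n + 1 := by omega
  obtain ⟨T, _, _, ev, tr, hd, hs, hc⟩ := exists_level k hn (levels n)
  have hT : (0 : ℝ) < Fintype.card T := Nat.cast_pos.2 Fintype.card_pos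
  have hVc : (Fintype.card (V n k) : ℝ) = 2 * n + 1 := by exact_mod_cast card_V hk1
  have hV0 : (0 : ℝ) < 2 * n + 1 := by positivity
  set p0 : ℝ := ((n : ℝ) + 1) / (2 * n + 1) with hp0
  have hp0le : p0 ≤ 1 := by rw [hp0, div_le_one hV0]; linarith
  have hp0ge : 0 ≤ p0 := by positivity
  have hmain : 1 - A^[levels n] p0 ≤ 1 / 3 * (1 / 2) ^ n := iterate_A_levels le_rfl hp0le
  -- the fraction of accepting seeds at a real input `x`
  have hfrac : ∀ x : Fin n → Bool,
      ((univ.filter fun ω => ev ω (virt n k x) = true).card : ℝ) / Fintype.card T =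
        A^[levels n] ((hammingWeight x + (n + 1 - k) : ℕ) / (2 * (n : ℝ) + 1)) := fun x => by
    rw [hc (virt n k x), card_virt, hVc, mul_div_cancel_left₀ _ hT.ne']
  obtain ⟨ω, hY, hN⟩ := exists_seed_of_frac (m := n) (fun ω x => ev ω (virt n k x))
    (fun x => k ≤ hammingWeight x) (fun x => hammingWeight x < k)
    (fun x h1 h2 => absurd h1 (not_le.2 h2))
    (ε := 1 / 3 * (1 / 2) ^ n) (by positivity)
    (by rw [← mul_assoc, mul_comm ((2 : ℝ) ^ n), mul_assoc, ← mul_pow]; norm_num)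
    (fun x hx => by
      show 1 - _ ≤ ((univ.filter fun ω => ev ω (virt n k x) = true).card : ℝ) / Fintype.card T
      rw [hfrac x]
      have hq : p0 ≤ ((hammingWeight x + (n + 1 - k) : ℕ) : ℝ) / (2 * (n : ℝ) + 1) := by
        rw [hp0]
        gcongr
        have : n + 1 ≤ hammingWeight x + (n + 1 - k) := by omega
        exact_mod_cast this
      have hq1 : ((hammingWeight x + (n + 1 - k) : ℕ) : ℝ) / (2 * (n : ℝ) + 1) ≤ 1 := by
        rw [div_le_one hV0]
        have : hammingWeight x + (n + 1 - k) ≤ 2 * n + 1 := by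
          have := hammingWeight_le x; omega
        exact_mod_cast this
      have := iterate_A_mono (levels n) hp0ge hq hq1
      linarith)
    (fun x hx => by
      show ((univ.filter fun ω => ev ω (virt n k x) = true).card : ℝ) / Fintype.card T ≤ _
      rw [hfrac x]
      have hq : ((hammingWeight x + (n + 1 - k) : ℕ) : ℝ) / (2 * (n : ℝ) + 1) ≤ 1 - p0 := by
        have e : 1 - p0 = (n : ℝ) / (2 * n + 1) := by
          rw [hp0]; field_simp; ring
        rw [e]
        gcongr
        have : hammingWeight x + (n + 1 - k) ≤ n := by omega
        exact_mod_cast this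
      have hq0 : 0 ≤ ((hammingWeight x + (n + 1 - k) : ℕ) : ℝ) / (2 * (n : ℝ) + 1) := by
        positivity
      have := iterate_A_mono (levels n) hq0 hq (by linarith)
      rw [iterate_A_symm] at this
      linarith)
  refine ⟨tr ω, ?_, ?_⟩
  · have := hd ω
    simp only [levels] at this
    omega
  · have hfun : (fun x => ev ω (virt n k x)) = thresholdFn n k := by
      funext x
      by_cases hx : k ≤ hammingWeight x
      · rw [hY x hx]; exact ((thresholdFn_eq_true_iff x).2 hx).symm
      · rw [hN x (not_le.1 hx)]; exact ((thresholdFn_eq_false_iff x).2 (not_le.1 hx)).symm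
    rw [← hfun]
    exact hs ω

/-- **`thresholdMonoKWLogDepth` holds** (Ajtai–Komlós–Szemerédi 1983 / Valiant 1984, Karchmer 1989
Thm. 4.1.1): discharge of the named fact of `ThresholdMonotoneKWDepth.lean`, with `c = 18`.
[cite: Valiant1984Majority, Theorem (p. 363)] [cite: Karchmer1989, §4.1 Thm 4.1.1 (p. 29)] -/
theorem thresholdMonoKWLogDepth_holds : thresholdMonoKWLogDepth :=
  ⟨18, fun n k hn _ => KWTree.exists_solvesMono_thresholdFn n k hn⟩

end Literature.Computability.Complexity

end
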